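import Mathlib
import Literature.Barriers.NavierStokesRegularity.DyadicCascadeExistence
import Literature.Barriers.NavierStokesRegularity.DyadicCascadeUniqueness
import Literature.Barriers.NavierStokesRegularity.DyadicCascadeRegionInvariance
import Literature.Barriers.NavierStokesRegularity.DyadicInvariantRegionNumerics
import HarnessLib

/-!
# The viscous dyadic model: the a priori bound in the scaling `λₙ^{β-2+ε}`
  (Barbato–Morandin–Romito 2011, §3.2, proof of Theorem 1, "first claim")

Barrier catalogue `Literature/Barriers/NavierStokesRegularity/`, sixth **proof file** towards the
named fact `Dyadic.BarbatoMorandinRomito2011_thm1` (`DyadicCascadeRegularity`). We prove the first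
claim of BMR's proof of Theorem 1 (§3.2): for `ν > 0`, `β ∈ (2, 5/2]`, a weak solution `X` of (1.1)
with non-negative square-summable datum, and a time `t₀ ≥ 0` at which
`K = sup_n λₙ^{β-2+ε}Xₙ(t₀) < ∞`, one has

  `sup_{t ≥ t₀} sup_n λₙ^{β-2+ε}Xₙ(t) ≤ K/δ = 10K`      (`IsBMRWeakSolution.scale_bound`),

with the explicit `ε = 1/100` of `DyadicCascadeRegionNumerics` (`δ = 1/10` is the parameter of the
invariant region).

## The printed argument and its transcription

BMR: rescale `Ȳₙ(t) = (δ/K₀)λₙ^{β-2+ε}Xₙ((δ/K₀)t)` (a solution of the rescaled system with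
viscosity `ν̄ = (δ/K₀)ν`), truncate ((2.2), border convention `Y_{N+1} = Y_N`), note
`sup_n Ȳₙ^{(N)}(t₀) ≤ δ` so that Lemma 2.1 gives `Y^{(N)} ≤ 1`, and pass to the limit `N → ∞`
("uniqueness of `(Xₙ)` clearly ensures uniqueness of `(Ȳₙ)` … and so it is standard to show that
the solutions of (2.2) converge to `(Ȳₙ)`"). Here:

* the solution is restarted at `t₀` (`IsBMRWeakSolution.shift`; datum `X(t₀)`, non-negative and
  square-summable by `DyadicCascadePositivity`);
* the truncations are the systems `T_N^κ` of `DyadicCascadeExistence` with `κ = 2^{-(β-2+ε)}`,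
  which in the variables `Yₙ = qλₙ^{β-2+ε}Xₙ` (`q = 1/(10K)`; amplitude scaling only — the time
  change of the paper is replaced by keeping the factor `1/q` in front of the quadratic terms,
  which the invariance lemma allows) is exactly BMR's (2.2): `Y_{N+1} = Y_N`,
  `Ẏₙ = -νλₙ²Yₙ + eₙ(Y_{n-1}² - G YₙY_{n+1})` with `eₙ = λₙ^β/(Gqλ_{n+1}^{β-2+ε})`,
  `e_{n+1} = 2^{2-ε}eₙ`, `G = 2^{6-2β-3ε}` (`hasDerivWithinAt_scaled`, the "straightforward
  computation" leading to (2.1)–(2.2); the identity `G·2^{3(β-2+ε)} = 2^β` is where `λ = 2` and the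
  value of `γ` enter);
* `region_invariant` (Lemma 2.1, `DyadicCascadeRegionInvariance`) applies: `1 ≤ G ≤ 4`,
  `G⁻¹ ≤ 0.511` for `β ∈ (2, 5/2]`, the data satisfy `Yₙ(0) ≤ qK = 1/10 = δ`, hence lie in the
  closed region; so `Yₙ^{(N)} ≤ 1`, i.e. `λₙ^{β-2+ε}Xₙ^{(N)} ≤ 10K`, for all `N`, `n ≤ N`, `t ≥ 0`;
* a subsequence of truncations converges at every mode and time to a weak solution with datum
  `X(t₀)` (`exists_weakSolution_of_truncated`), which is `X(t₀ + ·)` by uniqueness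
  (`IsBMRWeakSolution.unique`, Prop. 3.2, `β ≤ 5/2 ≤ 3`); the bound passes to the limit.

Theorem-only module. (A parallel formalisation of Lemma 2.1 for truncations, with `ε` kept
symbolic, is `DyadicInvariantRegion` / `DyadicInvariantRegionScaling`; from its numerics file we use
`two_rpow_mul_two_rpow_neg`.)

## References

* D. Barbato, F. Morandin, M. Romito, *Smooth solutions for the dyadic model*, Nonlinearity 24
  (2011) 3083–3097, §2 (2.1)–(2.2), Lemma 2.1; §3.2 proof of Thm. 1, first claim. [`BarbatoMorandinRomito2011`]
-/

noncomputable section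

open Set Filter
open scoped Topology

namespace Literature.Barriers.NavierStokesRegularity.Dyadic

/-! ## Powers of `2` -/

/-- `λ_{m+2}^r = 2^r λ_{m+1}^r` (real powers; `λ = 2`). [cite: BarbatoMorandinRomito2011, §1.1 (1.1)] -/
theorem bmrLambda_succ_succ_rpow (m : ℕ) (r : ℝ) :
    bmrLambda (m + 2) ^ r = (2 : ℝ) ^ r * bmrLambda (m + 1) ^ r := by
  rw [bmrLambda_succ_succ, Real.mul_rpow (by norm_num) (bmrLambda_nonneg _)]

/-- `λₙ^r > 0` for `n ≥ 1`. [folklore] -/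
theorem bmrLambda_rpow_pos {n : ℕ} (hn : n ≠ 0) (r : ℝ) : 0 < bmrLambda n ^ r :=
  Real.rpow_pos_of_pos (bmrLambda_pos hn) r

/-! ## The constants of the rescaled system for `ε = 1/100` -/

section Constants

variable {β : ℝ}

/-- `G = λ^γ = 2^{6-2β-3ε} ≥ 1` for `β ≤ 5/2` (`ε = 1/100`). [cite: BarbatoMorandinRomito2011, §2 Lemma 2.1 (proof)] -/
theorem one_le_G (hβ : β ≤ 5 / 2) : (1 : ℝ) ≤ (2 : ℝ) ^ (6 - 2 * β - 3 / 100) :=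
  Real.one_le_rpow (by norm_num) (by linarith)

/-- `G = 2^{6-2β-3ε} ≤ 4` for `β ≥ 2`. [cite: BarbatoMorandinRomito2011, §2 Lemma 2.1 (proof)] -/
theorem G_le_four (hβ : 2 ≤ β) : (2 : ℝ) ^ (6 - 2 * β - 3 / 100) ≤ 4 :=
  calc (2 : ℝ) ^ (6 - 2 * β - 3 / 100) ≤ (2 : ℝ) ^ (2 : ℝ) :=
      Real.rpow_le_rpow_of_exponent_le (by norm_num) (by linarith)
    _ = 4 := by rw [Real.rpow_two]; norm_num

/-- `c = G⁻¹ = 2^{-(6-2β-3ε)} ≤ 2^{3ε-1} ≤ 0.511` for `β ≤ 5/2`. [cite: BarbatoMorandinRomito2011, §2 Lemma 2.1 (proof)] -/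
theorem one_div_G_le (hβ : β ≤ 5 / 2) : 1 / (2 : ℝ) ^ (6 - 2 * β - 3 / 100) ≤ 511 / 1000 :=
  calc 1 / (2 : ℝ) ^ (6 - 2 * β - 3 / 100) = (2 : ℝ) ^ (-(6 - 2 * β - 3 / 100)) := by
        rw [one_div, Real.rpow_neg (by norm_num)]
    _ ≤ (2 : ℝ) ^ (-(97 : ℝ) / 100) := Real.rpow_le_rpow_of_exponent_le (by norm_num) (by linarith)
    _ ≤ 511 / 1000 := two_rpow_neg_97_div_100_le

/-- The exponent bookkeeping behind (2.1): `G · 2^{3(β-2+ε)} = 2^β` (`G = 2^{6-2β-3ε}`), i.e.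
`λ^γ c = 1` with `c = λ^{-γ}`, `γ = 6 - 2β - 3ε`. [cite: BarbatoMorandinRomito2011, §2 (2.1)] -/
theorem G_mul_two_rpow_cube (β : ℝ) :
    (2 : ℝ) ^ (6 - 2 * β - 3 / 100) * ((2 : ℝ) ^ (β - 2 + 1 / 100)) ^ 3 = (2 : ℝ) ^ β := by
  rw [← Real.rpow_mul_natCast (by norm_num : (0 : ℝ) ≤ 2), ← Real.rpow_add (by norm_num : (0 : ℝ) < 2)]
  congr 1
  push_cast
  ring

/-- `Λ · 2^{β-2+ε} = 2^β` with `Λ = λ^{2-ε} = 2^{199/100}`: the ratio of consecutive inviscid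
coefficients of (2.1). [cite: BarbatoMorandinRomito2011, §2 (2.1)] -/
theorem Lambda_mul_two_rpow (β : ℝ) :
    (2 : ℝ) ^ ((199 : ℝ) / 100) * (2 : ℝ) ^ (β - 2 + 1 / 100) = (2 : ℝ) ^ β := by
  rw [← Real.rpow_add (by norm_num : (0 : ℝ) < 2)]
  congr 1
  ring

end Constants

/-! ## The rescaled truncated system -/

section Scaled

variable {ν β q : ℝ} {N : ℕ} {U : ℕ → ℝ → ℝ}

/-- **The "straightforward computation" (2.1)–(2.2).** Let `U` solve the truncation `T_N^κ` of
(1.1), `ε = 1/100` (modes `1..N` solve (1.1); the values of `U₀` and `U_{N+1}` are immaterial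
here since `λ₀ = 0`), and put `Yₙ = qλₙ^{β-2+ε}Uₙ` (`q > 0`), `G = 2^{6-2β-3ε}`,
`eₙ = λₙ^β/(Gqλ_{n+1}^{β-2+ε})`. Then for `1 ≤ n ≤ N`, `t ≥ 0`:
`Ẏₙ = -νλₙ²Yₙ + eₙ(Y_{n-1}² - G YₙY_{n+1})`. [cite: BarbatoMorandinRomito2011, §2 (2.1)–(2.2)] -/
theorem hasDerivWithinAt_scaled (hβ : 2 < β) (hq : 0 < q)
    (hUd : ∀ m < N, ∀ t, 0 ≤ t →
      HasDerivWithinAt (U (m + 1)) (bmrRHS ν β (fun k => U k t) (m + 1)) (Ici 0) t)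
    {n : ℕ} (hn1 : 1 ≤ n) (hnN : n ≤ N) {t : ℝ} (ht : 0 ≤ t) :
    HasDerivWithinAt (fun τ => q * bmrLambda n ^ (β - 2 + 1 / 100) * U n τ)
      (-(ν * bmrLambda n ^ 2) * (q * bmrLambda n ^ (β - 2 + 1 / 100) * U n t) +
        bmrLambda n ^ β / ((2 : ℝ) ^ (6 - 2 * β - 3 / 100) * q * bmrLambda (n + 1) ^ (β - 2 + 1 / 100)) *
          ((q * bmrLambda (n - 1) ^ (β - 2 + 1 / 100) * U (n - 1) t) ^ 2 -
            (2 : ℝ) ^ (6 - 2 * β - 3 / 100) * (q * bmrLambda n ^ (β - 2 + 1 / 100) * U n t) *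
              (q * bmrLambda (n + 1) ^ (β - 2 + 1 / 100) * U (n + 1) t)))
      (Ici 0) t := by
  obtain ⟨m, rfl⟩ : ∃ m, n = m + 1 := ⟨n - 1, by omega⟩
  have hm : m < N := by omega
  set s : ℝ := β - 2 + 1 / 100 with hs
  set G : ℝ := (2 : ℝ) ^ (6 - 2 * β - 3 / 100) with hG
  have hs0 : 0 < s := by rw [hs]; linarith
  have hβ0 : β ≠ 0 := by linarith
  have hG0 : 0 < G := Real.rpow_pos_of_pos (by norm_num) _
  have h2s : 0 < (2 : ℝ) ^ s := Real.rpow_pos_of_pos (by norm_num) _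
  have hp : ∀ k : ℕ, 0 < bmrLambda (k + 1) ^ s := fun k => bmrLambda_rpow_pos (Nat.succ_ne_zero k) s
  have hG3 : G * ((2 : ℝ) ^ s) ^ 3 = (2 : ℝ) ^ β := G_mul_two_rpow_cube β
  -- the two coefficient identities
  have C3 : q * bmrLambda (m + 1) ^ s * bmrLambda (m + 1) ^ β =
      bmrLambda (m + 1) ^ β / (G * q * bmrLambda (m + 2) ^ s) * G * q ^ 2 *
        bmrLambda (m + 1) ^ s * bmrLambda (m + 2) ^ s := by
    have hden : G * q * bmrLambda (m + 2) ^ s ≠ 0 :=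
      (mul_pos (mul_pos hG0 hq) (bmrLambda_rpow_pos (by omega) s)).ne'
    rw [eq_comm]
    simp only [div_mul_eq_mul_div]
    rw [div_eq_iff hden]
    ring
  have C2 : q * bmrLambda (m + 1) ^ s * bmrLambda m ^ β =
      bmrLambda (m + 1) ^ β / (G * q * bmrLambda (m + 2) ^ s) * q ^ 2 *
        (bmrLambda m ^ s) ^ 2 := by
    rcases m with _ | k
    · simp [Real.zero_rpow hβ0, Real.zero_rpow hs0.ne']
    · have hp2 : bmrLambda (k + 1 + 1) ^ s = (2 : ℝ) ^ s * bmrLambda (k + 1) ^ s :=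
        bmrLambda_succ_succ_rpow k s
      have hp3 : bmrLambda (k + 1 + 2) ^ s = (2 : ℝ) ^ s * ((2 : ℝ) ^ s * bmrLambda (k + 1) ^ s) := by
        rw [show k + 1 + 2 = (k + 1) + 2 from rfl, bmrLambda_succ_succ_rpow (k + 1) s, hp2]
      have hb2 : bmrLambda (k + 1 + 1) ^ β = (2 : ℝ) ^ β * bmrLambda (k + 1) ^ β :=
        bmrLambda_succ_succ_rpow k β
      rw [hp2, hp3, hb2, ← hG3]
      have hden : G * q * ((2 : ℝ) ^ s * ((2 : ℝ) ^ s * bmrLambda (k + 1) ^ s)) ≠ 0 :=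
        (mul_pos (mul_pos hG0 hq) (mul_pos h2s (mul_pos h2s (hp k)))).ne'
      rw [eq_comm]
      simp only [div_mul_eq_mul_div]
      rw [div_eq_iff hden]
      ring
  have h := (hUd m hm t ht).const_mul (q * bmrLambda (m + 1) ^ s)
  refine h.congr_deriv ?_
  simp only [Nat.add_sub_cancel]
  rw [bmrRHS_succ]
  linear_combination (U m t ^ 2) * C2 - (U (m + 1) t * U (m + 2) t) * C3

end Scaled

/-! ## The a priori bound (first claim of the proof of Theorem 1) -/

section Bound

variable {ν β : ℝ} {x : ℕ → ℝ} {X : ℕ → ℝ → ℝ}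

/-- **Barbato–Morandin–Romito 2011, proof of Thm. 1, first claim** (with `ε = 1/100`,
`δ = 1/10`): for `ν > 0`, `β ∈ (2, 5/2]`, a weak solution of (1.1) with non-negative
square-summable datum and a time `t₀ ≥ 0` with `λₙ^{β-2+ε}Xₙ(t₀) ≤ K` for all `n ≥ 1` (`K > 0`),
one has `λₙ^{β-2+ε}Xₙ(t) ≤ K/δ = 10K` for all `t ≥ t₀`, `n ≥ 1`
("`sup_{t ≥ t₀} sup_n λ^{β-2+ε}Xₙ(t) ≤ δ⁻¹ sup_n λ^{β-2+ε}Xₙ(t₀)`"). Proof: rescaled truncations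
from the datum `X(t₀)` stay in the invariant region (`region_invariant`, via
`hasDerivWithinAt_scaled`), a subsequence converges to a weak solution with datum `X(t₀)`
(`exists_weakSolution_of_truncated`), which is `X(t₀ + ·)` by uniqueness. See the module
docstring. [cite: BarbatoMorandinRomito2011, §3.2 (proof of Thm. 1, first claim)] -/
theorem IsBMRWeakSolution.scale_bound (hX : IsBMRWeakSolution ν β x X) (hν : 0 < ν)
    (hβ2 : 2 < β) (hβ52 : β ≤ 5 / 2) (hx : ∀ n, 1 ≤ n → 0 ≤ x n)
    (hx2 : Summable fun n => x n ^ 2) {t₀ K : ℝ} (ht₀ : 0 ≤ t₀) (hK : 0 < K)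
    (hbd : ∀ n, 1 ≤ n → bmrLambda n ^ (β - 2 + 1 / 100) * X n t₀ ≤ K) :
    ∀ t, t₀ ≤ t → ∀ n, 1 ≤ n → bmrLambda n ^ (β - 2 + 1 / 100) * X n t ≤ 10 * K := by
  -- notation and constants
  set s : ℝ := β - 2 + 1 / 100 with hs
  set G : ℝ := (2 : ℝ) ^ (6 - 2 * β - 3 / 100) with hG
  set Λ : ℝ := (2 : ℝ) ^ ((199 : ℝ) / 100) with hΛ
  set κ : ℝ := (2 : ℝ) ^ (-s) with hκ
  set q : ℝ := 1 / (10 * K) with hq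
  have hβ0 : β ≠ 0 := by linarith
  have hs0 : 0 < s := by rw [hs]; linarith
  have hG0 : 0 < G := Real.rpow_pos_of_pos (by norm_num) _
  have hG1 : 1 ≤ G := one_le_G hβ52
  have hG4 : G ≤ 4 := G_le_four hβ2.le
  have hc : 1 / G ≤ 511 / 1000 := one_div_G_le hβ52
  have hκ0 : 0 ≤ κ := (Real.rpow_pos_of_pos (by norm_num) _).le
  have hq0 : 0 < q := by rw [hq]; positivity
  have hqK : q * K = 1 / 10 := by rw [hq]; field_simp
  -- the restarted solution and its datum
  set x' : ℕ → ℝ := fun n => X n t₀ with hx'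
  have hX' : IsBMRWeakSolution ν β x' (fun n t => X n (t + t₀)) := hX.shift ht₀
  have hx'0 : ∀ n, 1 ≤ n → 0 ≤ x' n := fun n hn => hX.nonneg hβ0 hx n hn t₀ ht₀
  have hx'2 : Summable fun n => x' n ^ 2 := hX.summable_sq hβ0 hν.le hx hx2 ht₀
  -- the truncations `T_N^κ` from the datum `x'`
  choose U hU0 hUN1 hUgt hUinit hUd using
    fun N => exists_truncated_solution (κ := κ) hν.le hβ0 hκ0 x' hx'0 N
  -- positivity of the truncations
  have hUcontN1 : ∀ N, ContinuousOn (U N (N + 1)) (Ici 0) := by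
    intro N
    have : U N (N + 1) = fun τ => κ * U N N τ := funext (hUN1 N)
    rw [this]
    refine continuousOn_const.mul ?_
    rcases Nat.eq_zero_or_pos N with h0 | hN
    · have : U N N = fun _ => 0 := by funext τ; rw [h0]; exact hU0 0 τ
      rw [this]; exact continuousOn_const
    · obtain ⟨M, hM⟩ : ∃ M, N = M + 1 := ⟨N - 1, by omega⟩
      intro τ hτ
      have := (hUd N M (by omega) τ hτ).continuousWithinAt
      rwa [← hM] at this
  have hUpos : ∀ N, ∀ m < N, ∀ t, 0 ≤ t → 0 ≤ U N (m + 1) t := fun N =>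
    nonneg_of_modes hβ0 (hUd N) (hUcontN1 N) fun m hm => by
      rw [hUinit N m hm]; exact hx'0 (m + 1) (by omega)
  have hUnonneg : ∀ N n t, 0 ≤ t → 0 ≤ U N n t := by
    intro N n t ht
    rcases Nat.eq_zero_or_pos n with rfl | hn
    · rw [hU0]
    obtain ⟨m, rfl⟩ : ∃ m, n = m + 1 := ⟨n - 1, by omega⟩
    by_cases hm : m < N
    · exact hUpos N m hm t ht
    by_cases hm' : m = N
    · subst hm'
      rw [hUN1]
      refine mul_nonneg hκ0 ?_
      rcases Nat.eq_zero_or_pos m with h0 | hmpos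
      · rw [h0, hU0]
      · obtain ⟨j, rfl⟩ : ∃ j, m = j + 1 := ⟨m - 1, by omega⟩
        exact hUpos (j + 1) j (by omega) t ht
    · rw [hUgt N (m + 1) (by omega)]
  -- Step 1: the invariant region for each truncation, in the variables `Y = q λ^s U`
  have hregion : ∀ N, ∀ t, 0 ≤ t → ∀ n, 1 ≤ n → n ≤ N →
      q * bmrLambda n ^ s * U N n t ≤ 1 := by
    intro N
    set Y : ℕ → ℝ → ℝ := fun n t => q * bmrLambda n ^ s * U N n t with hY
    set d : ℕ → ℝ := fun n => ν * bmrLambda n ^ 2 with hd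
    set e : ℕ → ℝ := fun n => bmrLambda n ^ β / (G * q * bmrLambda (n + 1) ^ s) with he
    have hdpos : ∀ n, 1 ≤ n → 0 < d n := fun n hn => by
      simp only [hd]; exact mul_pos hν (pow_pos (bmrLambda_pos (by omega)) 2)
    have hd4 : ∀ n, 1 ≤ n → d (n + 1) = 4 * d n := by
      intro n hn
      obtain ⟨m, rfl⟩ : ∃ m, n = m + 1 := ⟨n - 1, by omega⟩
      simp only [hd, bmrLambda_succ_succ]
      ring
    have hepos : ∀ n, 1 ≤ n → 0 < e n := fun n hn => by
      simp only [he]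
      exact div_pos (bmrLambda_rpow_pos (by omega) β)
        (mul_pos (mul_pos hG0 hq0) (bmrLambda_rpow_pos (by omega) s))
    have heΛ : ∀ n, 1 ≤ n → e (n + 1) = Λ * e n := by
      intro n hn
      obtain ⟨m, rfl⟩ : ∃ m, n = m + 1 := ⟨n - 1, by omega⟩
      simp only [he]
      have hp3 : bmrLambda (m + 1 + 1 + 1) ^ s = (2 : ℝ) ^ s * bmrLambda (m + 2) ^ s :=
        bmrLambda_succ_succ_rpow (m + 1) s
      have hb2 : bmrLambda (m + 1 + 1) ^ β = (2 : ℝ) ^ β * bmrLambda (m + 1) ^ β :=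
        bmrLambda_succ_succ_rpow m β
      have key : (2 : ℝ) ^ β = Λ * (2 : ℝ) ^ s := by
        rw [hΛ, hs]; exact (Lambda_mul_two_rpow β).symm
      rw [hp3, hb2, show m + 1 + 1 = m + 2 from rfl, key]
      have h2s : 0 < (2 : ℝ) ^ s := Real.rpow_pos_of_pos (by norm_num) _
      have hp2 : 0 < bmrLambda (m + 2) ^ s := bmrLambda_rpow_pos (by omega) s
      have hden1 : G * q * ((2 : ℝ) ^ s * bmrLambda (m + 2) ^ s) ≠ 0 :=
        (mul_pos (mul_pos hG0 hq0) (mul_pos h2s hp2)).ne'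
      have hden2 : G * q * bmrLambda (m + 2) ^ s ≠ 0 := (mul_pos (mul_pos hG0 hq0) hp2).ne'
      rw [div_eq_iff hden1, mul_div_assoc', div_mul_eq_mul_div, eq_div_iff hden2]
      ring
    have hY0 : ∀ t, Y 0 t = 0 := fun t => by simp only [hY, hU0, mul_zero]
    have hYN : ∀ t, Y (N + 1) t = Y N t := by
      intro t
      simp only [hY]
      rw [hUN1]
      rcases Nat.eq_zero_or_pos N with h0 | hN
      · rw [h0, hU0]; simp
      · obtain ⟨M, rfl⟩ : ∃ M, N = M + 1 := ⟨N - 1, by omega⟩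
        rw [show M + 1 + 1 = M + 2 from rfl, bmrLambda_succ_succ_rpow M s]
        have : (2 : ℝ) ^ s * κ = 1 := two_rpow_mul_two_rpow_neg s
        calc q * ((2 : ℝ) ^ s * bmrLambda (M + 1) ^ s) * (κ * U (M + 1) (M + 1) t)
            = ((2 : ℝ) ^ s * κ) * (q * bmrLambda (M + 1) ^ s * U (M + 1) (M + 1) t) := by ring
          _ = q * bmrLambda (M + 1) ^ s * U (M + 1) (M + 1) t := by rw [this, one_mul]
    have hderivY : ∀ n, 1 ≤ n → n ≤ N → ∀ t, 0 ≤ t → HasDerivWithinAt (Y n)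
        (-d n * Y n t + e n * (Y (n - 1) t ^ 2 - G * Y n t * Y (n + 1) t)) (Ici 0) t := by
      intro n hn1 hnN t ht
      have h := hasDerivWithinAt_scaled (ν := ν) hβ2 hq0 (hUd N) hn1 hnN ht
      simp only [hY, hd, he]
      convert h using 2
    have hposY : ∀ n t, 0 ≤ t → 0 ≤ Y n t := fun n t ht =>
      mul_nonneg (mul_nonneg hq0.le (Real.rpow_nonneg (bmrLambda_nonneg n) s)) (hUnonneg N n t ht)
    -- the data lie in the `δ`-box, hence in the closed region
    have hYinit : ∀ n, 1 ≤ n → n ≤ N → Y n 0 ≤ 1 / 10 := by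
      intro n hn1 hnN
      obtain ⟨m, rfl⟩ : ∃ m, n = m + 1 := ⟨n - 1, by omega⟩
      simp only [hY]
      rw [hUinit N m (by omega), mul_assoc, ← hqK]
      exact mul_le_mul_of_nonneg_left (hbd (m + 1) hn1) hq0.le
    have h1 : ∀ n, 1 ≤ n → n ≤ N → Y n 0 ≤ 1 := fun n hn1 hnN =>
      (hYinit n hn1 hnN).trans (by norm_num)
    have hup : ∀ n, 1 ≤ n → n + 1 ≤ N → Y (n + 1) 0 ≤ 3 / 4 * Y n 0 + 3 / 5 := by
      intro n hn1 hnN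
      have := hYinit (n + 1) (by omega) hnN
      have := hposY n 0 le_rfl
      linarith
    have hlow : ∀ n, 1 ≤ n → n + 1 ≤ N →
        1 / G * (max (Y n 0 - 1 / 10) 0 / (9 / 10)) ^ 4 ≤ Y (n + 1) 0 := by
      intro n hn1 hnN
      rw [hlow_eq_zero_of_le G (hYinit n hn1 (by omega))]
      exact hposY (n + 1) 0 le_rfl
    have hinv := region_invariant (N := N) two_rpow_199_div_100_ge two_rpow_199_div_100_le hG1 hG4
      hc hdpos hd4 hepos heΛ hY0 hYN hderivY hposY h1 hup hlow
    intro t ht n hn1 hnN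
    exact (hinv t ht).1 n hn1 hnN
  -- Step 2: the bound `λ^s U ≤ 10 K` for every truncation
  have hUbd : ∀ N, ∀ t, 0 ≤ t → ∀ n, 1 ≤ n → n ≤ N →
      bmrLambda n ^ s * U N n t ≤ 10 * K := by
    intro N t ht n hn1 hnN
    have h := hregion N t ht n hn1 hnN
    rw [mul_assoc, hq, one_div_mul_eq_div, div_le_one (by positivity)] at h
    exact h
  -- Step 3: passage to the limit and identification by uniqueness
  obtain ⟨φ, Xl, hφ, hXl, -, hconv⟩ := exists_weakSolution_of_truncated hν.le hβ0 hκ0 hx'0 hx'2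
    hU0 hUN1 hUgt hUinit hUd
  have hβ3 : β ≤ 3 := by linarith
  have huniq := hXl.unique hX' hν (by linarith) hβ3 hx'0 hx'2
  intro t ht n hn1
  have ht' : 0 ≤ t - t₀ := by linarith
  have hlim : Tendsto (fun j => bmrLambda n ^ s * U (φ j) n (t - t₀)) atTop
      (𝓝 (bmrLambda n ^ s * Xl n (t - t₀))) := (hconv n (t - t₀) ht').const_mul _
  have hle : bmrLambda n ^ s * Xl n (t - t₀) ≤ 10 * K := by
    refine le_of_tendsto hlim ?_
    filter_upwards [hφ.tendsto_atTop.eventually (eventually_ge_atTop n)] with j hj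
    exact hUbd (φ j) (t - t₀) ht' n hn1 hj
  have hid : Xl n (t - t₀) = X n t := by
    rw [huniq n hn1 (t - t₀) ht', sub_add_cancel]
  rw [← hid]
  exact hle

end Bound

end Literature.Barriers.NavierStokesRegularity.Dyadic
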